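import Summits.BirchSwinnertonDyer.BirchSwinnertonDyer.Theorems.KimAtThreeFineKatoKPortResidueField
import Literature.NumberTheory.EllipticCurves.SingularCubic
import Mathlib.NumberTheory.Padics.RingHoms
import HarnessLib

/-!
# K-PORT glue (toward `hres`, step r2 at `p = 3`): the reduction of an additively reducing `M/ℤ₃`
# over the residue field of ANY `K ⊇ ℚ₃` IS the cuspidal singular model with `𝔽₃`-RATIONAL data
# `x₀ = −b₆`, `y₀ = a₁x₀ + a₃`, `α = a₁`
# (cell `bsd-addord`, seat w2-kport gen 2; `--supports stmt-BirchSwinnertonDyer-19560`, helper)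

HONEST FRAMING. Route W2 (`route-BirchSwinnertonDyer-KimAtThreeKolyvagin`), crux 19560
`KatoKuriharaPortThreeShared`, residual ⟨C1⟩ clause (C1.c). The cusp chart of `…KPortCuspChart` and the
unit-trace point of `…KPortUnitTracePoint` take as hypothesis `hV : Ṽ = singularModel x̄₀ ȳ₀ ᾱ ᾱ` with
`x₀, y₀, α ∈ ℤ_p` (a `k`-rational cusp chart commuting with `Gal(K/ℚ_p)`; the tree's
`SingularCubic.exists_singularPoint` / `exists_tangentSlopes` only give the data over an algebraically
closed field). At `p = 3` the data are EXPLICIT and lie in `ℤ₃`: in characteristic `3`, `c̃₄ = b̃₂²` and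
(once `b̃₂ = 0`) `Δ̃ = −8 b̃₄³`, so a cusp has `b̃₂ = b̃₄ = 0`; the `2`-division cubic is then `x³ + b̃₆`
with `b̃₆ ∈ 𝔽₃`, whose triple root is `x₀ = −b̃₆` (`t³ = t` on `𝔽₃`); `y₀ = −(ã₁x₀ + ã₃)/2 = ã₁x₀ + ã₃`
and the double tangent slope is `α = −ã₁/2 = ã₁`. This file verifies the five identities of the tree's
`WeierstrassCurve.eq_singularModel` for these values (`linear_combination` modulo `3 = 0`):

  `map_residue_eq_singularModel_of_three`: for `M/ℤ_p`, `p = 3`, `‖Δ(M)‖ < 1`, `‖c₄(M)‖ < 1` and any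
  ultrametric `K ⊇ ℚ_p`, `(M ⊗ 𝒪_K) mod 𝔪_K = singularModel (−b₆)‾ (a₁·(−b₆) + a₃)‾ ā₁ ā₁`.

TOOL theorems only (no definition, no named fact, no `sorry`); closes nothing by itself; nothing booked.
The analogous statements at `p ≥ 5` (`x₀ = −b₂/12`, `y₀ = −(a₁x₀ + a₃)/2`, `α = −a₁/2`) and `p = 2` are
NOT here (route W2 is at `p = 3`).

References: J. H. Silverman, *The Arithmetic of Elliptic Curves*, 2nd ed. (2009), III.1 (b- and
c-quantities), Prop. III.1.4(a), III.2.5, App. A Prop. 1.1–1.2 [SilvermanAEC2009].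
-/

noncomputable section

-- the cell's Theorems namespace `Summit.BirchSwinnertonDyer.BirchSwinnertonDyer.…` repeats the summit name by design (D-0017)
set_option linter.dupNamespace false

open scoped Classical NNReal

namespace Summit.BirchSwinnertonDyer.BirchSwinnertonDyer.Theorems.KPort

open Summit.BirchSwinnertonDyer.Rank1Residual.Additive.BallEval
open Literature.NumberTheory.GaloisRepresentations.LubinTate (unitBall mem_unitBall_iff)
open WeierstrassCurve

variable {p : ℕ} [hp : Fact p.Prime] {K : Type*} [NontriviallyNormedField K] [NormedAlgebra ℚ_[p] K]
  [IsUltrametricDist K]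

/-- The image in `k = 𝒪_K/𝔪_K` of an element of `ℤ_p` is the image of a natural number `< p`
(`ℤ_p = ℤ + pℤ_p`). [folklore] -/
theorem exists_residue_coeffHom_eq_natCast (z : ℤ_[p]) :
    ∃ n : ℕ, n < p ∧ IsLocalRing.residue (unitBall K) (coeffHom p K z) = n := by
  obtain ⟨n, hn, hz⟩ := PadicInt.exists_mem_range z
  refine ⟨n, hn, ?_⟩
  rw [IsLocalRing.mem_maximalIdeal, PadicInt.mem_nonunits] at hz
  have h0 : IsLocalRing.residue (unitBall K) (coeffHom p K (z - n)) = 0 :=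
    residue_eq_zero_of_norm_lt_one (by rw [norm_coe_coeffHom]; exact hz)
  rw [map_sub, map_sub, map_natCast, map_natCast, sub_eq_zero] at h0
  exact h0

/-- At `p = 3`: every element of the image of `ℤ₃` in `k` satisfies `t³ = t`. [folklore] -/
theorem residue_coeffHom_pow_three (hp3 : p = 3) (z : ℤ_[p]) :
    IsLocalRing.residue (unitBall K) (coeffHom p K z) ^ 3 = IsLocalRing.residue (unitBall K) (coeffHom p K z) := by
  have h3 : (3 : IsLocalRing.ResidueField (unitBall K)) = 0 := by
    have h := natCast_prime_residueField_eq_zero (p := p) (K := K)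
    rw [hp3] at h
    exact_mod_cast h
  obtain ⟨n, hn, hzn⟩ := exists_residue_coeffHom_eq_natCast (K := K) z
  rw [hzn]
  rw [hp3] at hn
  interval_cases n
  · simp
  · simp
  · push_cast
    linear_combination (2 : IsLocalRing.ResidueField (unitBall K)) * h3

variable {M : WeierstrassCurve ℤ_[p]}

/-- At a cusp in characteristic `3`: `b̃₂ = 0` (`c̃₄ = b̃₂² − 24 b̃₄ = b̃₂²`). [cite: SilvermanAEC2009, III.1 and App. A Prop. 1.1] -/
theorem residue_b₂_eq_zero_of_three (hp3 : p = 3) (hc₄ : ‖M.c₄‖ < 1) :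
    ((M.map (coeffHom p K)).map (IsLocalRing.residue (unitBall K))).b₂ = 0 := by
  set V := (M.map (coeffHom p K)).map (IsLocalRing.residue (unitBall K)) with hVdef
  have h3 : (3 : IsLocalRing.ResidueField (unitBall K)) = 0 := by
    have h := natCast_prime_residueField_eq_zero (p := p) (K := K)
    rw [hp3] at h
    exact_mod_cast h
  have hc : V.b₂ ^ 2 - 24 * V.b₄ = 0 := by
    have h := residue_c₄_map_coeffHom_eq_zero (K := K) hc₄
    rw [← map_c₄] at h
    exact h
  have hsq : V.b₂ ^ 2 = 0 := by linear_combination hc + 8 * V.b₄ * h3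
  exact pow_eq_zero_iff (two_ne_zero) |>.mp hsq

/-- At a cusp in characteristic `3`: `b̃₄ = 0` (`Δ̃ = −8 b̃₄³` once `b̃₂ = 0`, `27 = 0`).
[cite: SilvermanAEC2009, III.1 and App. A Prop. 1.1] -/
theorem residue_b₄_eq_zero_of_three (hp3 : p = 3) (hΔ : ‖M.Δ‖ < 1) (hc₄ : ‖M.c₄‖ < 1) :
    ((M.map (coeffHom p K)).map (IsLocalRing.residue (unitBall K))).b₄ = 0 := by
  set V := (M.map (coeffHom p K)).map (IsLocalRing.residue (unitBall K)) with hVdef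
  have h3 : (3 : IsLocalRing.ResidueField (unitBall K)) = 0 := by
    have h := natCast_prime_residueField_eq_zero (p := p) (K := K)
    rw [hp3] at h
    exact_mod_cast h
  have hb₂ : V.b₂ = 0 := residue_b₂_eq_zero_of_three hp3 hc₄
  have hD : -V.b₂ ^ 2 * V.b₈ - 8 * V.b₄ ^ 3 - 27 * V.b₆ ^ 2 + 9 * V.b₂ * V.b₄ * V.b₆ = 0 := by
    have h := residue_Δ_map_coeffHom_eq_zero (K := K) hΔ
    rw [← map_Δ] at h
    exact h
  have hcube : V.b₄ ^ 3 = 0 := by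
    linear_combination hD + (V.b₂ * V.b₈ - 9 * V.b₄ * V.b₆) * hb₂ + (3 * V.b₄ ^ 3 + 9 * V.b₆ ^ 2) * h3
  exact pow_eq_zero_iff (by norm_num) |>.mp hcube

/-- **The `𝔽₃`-rational cusp model at `p = 3`.** For `M/ℤ_p` with `p = 3`, `‖Δ(M)‖ < 1` and `‖c₄(M)‖ < 1`
(additive reduction), and any ultrametric `K ⊇ ℚ_p`, the reduced cubic `Ṽ = (M ⊗ 𝒪_K) mod 𝔪_K` IS the
singular model with cusp `(x₀, y₀) = (−b̃₆, ã₁x₀ + ã₃)` and double tangent slope `α = ã₁`, all three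
images of elements of `ℤ_p`. [cite: SilvermanAEC2009, Prop. III.1.4(a) and III.2.5] -/
theorem map_residue_eq_singularModel_of_three (hp3 : p = 3) (hΔ : ‖M.Δ‖ < 1) (hc₄ : ‖M.c₄‖ < 1) :
    (M.map (coeffHom p K)).map (IsLocalRing.residue (unitBall K)) =
      singularModel (IsLocalRing.residue (unitBall K) (coeffHom p K (-M.b₆)))
        (IsLocalRing.residue (unitBall K) (coeffHom p K (M.a₁ * -M.b₆ + M.a₃)))
        (IsLocalRing.residue (unitBall K) (coeffHom p K M.a₁))
        (IsLocalRing.residue (unitBall K) (coeffHom p K M.a₁)) := by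
  set V := (M.map (coeffHom p K)).map (IsLocalRing.residue (unitBall K)) with hVdef
  have h3 : (3 : IsLocalRing.ResidueField (unitBall K)) = 0 := by
    have h := natCast_prime_residueField_eq_zero (p := p) (K := K)
    rw [hp3] at h
    exact_mod_cast h
  have hb₂ : V.a₁ ^ 2 + 4 * V.a₂ = 0 := residue_b₂_eq_zero_of_three (K := K) hp3 hc₄
  have hb₄ : 2 * V.a₄ + V.a₁ * V.a₃ = 0 := residue_b₄_eq_zero_of_three (K := K) hp3 hΔ hc₄
  have eb₆ : V.b₆ = IsLocalRing.residue (unitBall K) (coeffHom p K M.b₆) := by rw [hVdef, map_b₆, map_b₆]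
  have hcube : (V.a₃ ^ 2 + 4 * V.a₆) ^ 3 = V.a₃ ^ 2 + 4 * V.a₆ := by
    have h := residue_coeffHom_pow_three (K := K) hp3 M.b₆
    rw [← eb₆] at h
    exact h
  have e₁ : IsLocalRing.residue (unitBall K) (coeffHom p K (-M.b₆)) = -(V.a₃ ^ 2 + 4 * V.a₆) := by
    rw [map_neg, map_neg, ← eb₆]; rfl
  have e₂ : IsLocalRing.residue (unitBall K) (coeffHom p K (M.a₁ * -M.b₆ + M.a₃)) =
      V.a₁ * -(V.a₃ ^ 2 + 4 * V.a₆) + V.a₃ := by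
    rw [map_add, map_add, map_mul, map_mul, map_neg, map_neg, ← eb₆]; rfl
  have e₃ : IsLocalRing.residue (unitBall K) (coeffHom p K M.a₁) = V.a₁ := rfl
  rw [e₁, e₂, e₃]
  refine eq_singularModel V ?_ ?_ ?_ ?_ ?_
  · rw [WeierstrassCurve.Affine.equation_iff]
    change (V.a₁ * -(V.a₃ ^ 2 + 4 * V.a₆) + V.a₃) ^ 2 + V.a₁ * -(V.a₃ ^ 2 + 4 * V.a₆) * (V.a₁ * -(V.a₃ ^ 2 + 4 * V.a₆) + V.a₃)
        + V.a₃ * (V.a₁ * -(V.a₃ ^ 2 + 4 * V.a₆) + V.a₃) =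
      (-(V.a₃ ^ 2 + 4 * V.a₆)) ^ 3 + V.a₂ * (-(V.a₃ ^ 2 + 4 * V.a₆)) ^ 2 + V.a₄ * -(V.a₃ ^ 2 + 4 * V.a₆) + V.a₆
    linear_combination (2 * (V.a₃ ^ 2 + 4 * V.a₆) ^ 2) * hb₂ + (4 * -(V.a₃ ^ 2 + 4 * V.a₆)) * hb₄ + hcube
      + (V.a₃ ^ 2 + V.a₆ - 3 * V.a₂ * (V.a₃ ^ 2 + 4 * V.a₆) ^ 2 - 3 * V.a₄ * -(V.a₃ ^ 2 + 4 * V.a₆)) * h3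
  · linear_combination (-(V.a₃ ^ 2 + 4 * V.a₆)) * hb₂ + hb₄
      - (2 * V.a₂ * -(V.a₃ ^ 2 + 4 * V.a₆) + V.a₄ + (V.a₃ ^ 2 + 4 * V.a₆) ^ 2) * h3
  · linear_combination (V.a₁ * -(V.a₃ ^ 2 + 4 * V.a₆) + V.a₃) * h3
  · linear_combination V.a₁ * h3
  · linear_combination hb₂ + (-(V.a₃ ^ 2 + 4 * V.a₆) - V.a₂) * h3

end Summit.BirchSwinnertonDyer.BirchSwinnertonDyer.Theorems.KPort

end
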